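/-
Copyright (c) 2026. All rights reserved.
Released under Apache 2.0 license as described in the file LICENSE.
Authors: HodgeCM publication cell (pub-hodgecm), DAG-node prover lineage #14 (gen 6: statements and proofs;
gen 7: tree port).
-/
import Literature.Analysis.Distribution.SchwartzLinearFlowDeriv
import HarnessLib

/-!
# Product rules for difference quotients in Schwartz space

Topic `Analysis/Distribution`; namespace `Literature.Analysis.Distribution`.  The smooth-vector statements
`SchwartzLinearFlowDeriv` (linear changes of variables `Φ ∘ L(t)`), `SchwartzTranslationFlowDeriv`
(translations) and multiplier families each treat ONE kind of one-parameter family acting on `𝓢(E, F)`.  A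
general one-parameter subgroup of an affine or metaplectic action is a COMPOSITE of such families, possibly
with a scalar factor (a half-density character `|det a|^{1/2}`, a unitary character `χ(t)`), so one needs
product rules at the level of difference quotients in the Fréchet space `𝓢(E, F)` — where `HasDerivAt` is
not available, `𝓢` not being normed.  This file proves them, with hypotheses the files above verify:

* `tendsto_smul_sub_div` — **scalar factors**: `c : ℝ → 𝕜` with `c 0 = 1`, `HasDerivAt c c' 0`, and a
  trajectory `w : ℝ → 𝓢(E, F)` with `t⁻¹ • (w t - Φ) → Y` give `t⁻¹ • (c t • w t - Φ) → c' • Φ + Y`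
  (`tendsto_smul_sub_div_of_mul`: base-point form for multiplicative `c`);
* `tendsto_comp_sub_div` — **operator families**: if `U : ℝ → (𝓢 →L[ℝ] 𝓢)` is *locally equicontinuous*
  near `t = 0` (every Schwartz seminorm of `U t Ψ` bounded by finitely many seminorms of `Ψ`, uniformly for
  `t` near `0`), `U t Y → Y`, `t⁻¹ • (U t Φ - Φ) → X` and `t⁻¹ • (w t - Φ) → Y`, then
  `t⁻¹ • (U t (w t) - Φ) → X + Y` — the Banach–Steinhaus-type step of every strong-derivative product rule
  (cf. M. Reed, B. Simon, *Methods of Modern Mathematical Physics I*, Thm. VIII.7 ff. and §V.3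
  [ReedSimonI1980]), here with equicontinuity as an explicit hypothesis instead of barrelledness;
* `eventually_seminorm_compCLM_le`, `tendsto_compCLM_of_tendsto_one` — the composition operators
  `Φ ↦ Φ ∘ L t` of a family of linear automorphisms with `L t → 1` in operator norm ARE locally
  equicontinuous and strongly continuous on `𝓢(E, F)` (from the quantitative estimate
  `seminorm_compCLM_sub_le` of `SchwartzLinearFlowEstimates`);
* `tendsto_compCLM_apply_sub_div` — hence, for `L` differentiable at `0` with `L 0 = 1`, `L'(0) = A`, and ANY
  trajectory `w` with `t⁻¹ • (w t - Φ) → Y`: `t⁻¹ • ((w t) ∘ L t - Φ) → flowGen A Φ + Y` in `𝓢(E, F)`;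
  `tendsto_compCLM_compCLM_sub_div` — two linear flows composed.

Design: filters `𝓝[≠] 0` throughout, equicontinuity phrased with `Finset (ℕ × ℕ)` sums of seminorms so that
it composes.  NOT here: joint smoothness / higher derivatives (file `SchwartzFlowSmooth`).

Provenance: tree port (LEAN-IN-TREE, 2026-08-18) of the HodgeCM publication cell's package files
`HodgeCM/Automorphic/SchwartzScalarProductRule.lean` and `HodgeCM/Automorphic/SchwartzFlowProductRule.lean`
(unit `pub-hodgecm-pv14-g6`, gate run 31; namespace `HodgeCM.SchwartzWeil` ↦ `Literature.Analysis.Distribution`,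
statements verbatim).  Nothing in this file is specific to that cell or under adjudication there.
-/

set_option autoImplicit false

noncomputable section

open Filter Topology
open scoped SchwartzMap

namespace Literature.Analysis.Distribution

variable {E F : Type*} [NormedAddCommGroup E] [NormedSpace ℝ E] [NormedAddCommGroup F]
  [NormedSpace ℝ F]

/-! ## Scalar factors -/

/-- **Scalar product rule** for difference quotients in `𝓢(E, F)`. [folklore] -/
theorem tendsto_smul_sub_div {𝕜 : Type*} [RCLike 𝕜] [NormedSpace 𝕜 F] [SMulCommClass ℝ 𝕜 F]
    [IsScalarTower ℝ 𝕜 F] {c : ℝ → 𝕜} {c' : 𝕜} (hc0 : c 0 = 1) (hc : HasDerivAt c c' 0)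
    {w : ℝ → 𝓢(E, F)} {Φ Y : 𝓢(E, F)}
    (hw : Tendsto (fun t : ℝ => t⁻¹ • (w t - Φ)) (𝓝[≠] 0) (𝓝 Y)) :
    Tendsto (fun t : ℝ => t⁻¹ • (c t • w t - Φ)) (𝓝[≠] 0) (𝓝 (c' • Φ + Y)) := by
  have h1 : Tendsto c (𝓝[≠] 0) (𝓝 1) := by
    have h := hc.continuousAt.tendsto
    rw [hc0] at h
    exact h.mono_left nhdsWithin_le_nhds
  have h2 : Tendsto (fun t : ℝ => t⁻¹ • (c t - 1)) (𝓝[≠] 0) (𝓝 c') := by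
    have h := hasDerivAt_iff_tendsto_slope_zero.mp hc
    simpa only [zero_add, hc0] using h
  have hA := h1.smul hw
  rw [one_smul] at hA
  have hB := h2.smul_const Φ
  have hsum := hB.add hA
  refine hsum.congr fun t => ?_
  show (t⁻¹ • (c t - 1)) • Φ + c t • (t⁻¹ • (w t - Φ)) = t⁻¹ • (c t • w t - Φ)
  rw [smul_assoc, ← smul_comm t⁻¹ (c t) (w t - Φ), ← smul_add]
  congr 1
  simp only [sub_smul, one_smul, smul_sub]
  abel

/-- The same with the scalar factor differentiated at a base point `s₀` with `c s₀ ≠ 0` is obtained by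
factoring `c (s₀ + t) = c s₀ • (c (s₀ + t) / c s₀)`; we record the special case most used:
a real character-like factor `c (s₀ + t) = c s₀ * c t`. [folklore] -/
theorem tendsto_smul_sub_div_of_mul {𝕜 : Type*} [RCLike 𝕜] [NormedSpace 𝕜 F] [SMulCommClass ℝ 𝕜 F]
    [IsScalarTower ℝ 𝕜 F] {c : ℝ → 𝕜} {c' : 𝕜} (hc0 : c 0 = 1) (hc : HasDerivAt c c' 0)
    (hmul : ∀ s t, c (s + t) = c s * c t)
    {w : ℝ → 𝓢(E, F)} {Φ Y : 𝓢(E, F)} (s₀ : ℝ)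
    (hw : Tendsto (fun t : ℝ => t⁻¹ • (w t - Φ)) (𝓝[≠] 0) (𝓝 Y)) :
    Tendsto (fun t : ℝ => t⁻¹ • (c (s₀ + t) • w t - c s₀ • Φ)) (𝓝[≠] 0)
      (𝓝 (c s₀ • (c' • Φ + Y))) := by
  have h := (tendsto_smul_sub_div (E := E) hc0 hc hw).const_smul (c s₀)
  refine h.congr fun t => ?_
  show c s₀ • (t⁻¹ • (c t • w t - Φ)) = t⁻¹ • (c (s₀ + t) • w t - c s₀ • Φ)
  rw [hmul, smul_comm (c s₀) t⁻¹, smul_sub, smul_smul]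


/-! ## The abstract product rule -/

/-- A locally equicontinuous family applied to a null net gives a null net. [folklore] -/
theorem tendsto_apply_zero_of_equicontinuous {ι : Type*} {l : Filter ι}
    {U : ι → (𝓢(E, F) →L[ℝ] 𝓢(E, F))} {g : ι → 𝓢(E, F)}
    (hUeq : ∀ k n : ℕ, ∃ s : Finset (ℕ × ℕ), ∃ C : ℝ, ∀ᶠ t in l, ∀ Ψ : 𝓢(E, F),
      SchwartzMap.seminorm ℝ k n (U t Ψ) ≤ C * ∑ i ∈ s, SchwartzMap.seminorm ℝ i.1 i.2 Ψ)
    (hg : Tendsto g l (𝓝 0)) : Tendsto (fun t => U t (g t)) l (𝓝 0) := by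
  rw [(schwartz_withSeminorms ℝ E F).tendsto_nhds]
  rintro ⟨k, n⟩ ε hε
  obtain ⟨s, C, hC⟩ := hUeq k n
  have hi : ∀ i : ℕ × ℕ, Tendsto (fun t => SchwartzMap.seminorm ℝ i.1 i.2 (g t)) l (𝓝 0) := by
    intro i
    have hc := ((schwartz_withSeminorms ℝ E F).continuous_seminorm i).tendsto (0 : 𝓢(E, F))
    rw [SchwartzMap.schwartzSeminormFamily_apply, map_zero] at hc
    exact hc.comp hg
  have hsum : Tendsto (fun t => C * ∑ i ∈ s, SchwartzMap.seminorm ℝ i.1 i.2 (g t)) l (𝓝 0) := by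
    have h := (tendsto_finsetSum s fun i _ => hi i).const_mul C
    simpa only [Finset.sum_const_zero, mul_zero] using h
  filter_upwards [hC, hsum.eventually_lt_const hε] with t htC hlt
  rw [SchwartzMap.schwartzSeminormFamily_apply, sub_zero]
  exact (htC (g t)).trans_lt hlt

/-- **Product rule for difference quotients in `𝓢(E, F)`.**  `U` a locally equicontinuous family of
continuous linear operators near `t = 0` with `U t Y → Y`; if `t⁻¹ • (U t Φ - Φ) → X` and
`t⁻¹ • (w t - Φ) → Y` then `t⁻¹ • (U t (w t) - Φ) → X + Y` (all limits in the Schwartz topology,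
`t → 0`, `t ≠ 0`). [folklore] -/
theorem tendsto_comp_sub_div {U : ℝ → (𝓢(E, F) →L[ℝ] 𝓢(E, F))} {w : ℝ → 𝓢(E, F)}
    {Φ X Y : 𝓢(E, F)}
    (hUeq : ∀ k n : ℕ, ∃ s : Finset (ℕ × ℕ), ∃ C : ℝ, ∀ᶠ t in 𝓝[≠] (0 : ℝ), ∀ Ψ : 𝓢(E, F),
      SchwartzMap.seminorm ℝ k n (U t Ψ) ≤ C * ∑ i ∈ s, SchwartzMap.seminorm ℝ i.1 i.2 Ψ)
    (hUY : Tendsto (fun t => U t Y) (𝓝[≠] 0) (𝓝 Y))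
    (hU : Tendsto (fun t : ℝ => t⁻¹ • (U t Φ - Φ)) (𝓝[≠] 0) (𝓝 X))
    (hw : Tendsto (fun t : ℝ => t⁻¹ • (w t - Φ)) (𝓝[≠] 0) (𝓝 Y)) :
    Tendsto (fun t : ℝ => t⁻¹ • (U t (w t) - Φ)) (𝓝[≠] 0) (𝓝 (X + Y)) := by
  have hq0 : Tendsto (fun t : ℝ => t⁻¹ • (w t - Φ) - Y) (𝓝[≠] 0) (𝓝 0) := by
    rw [← sub_self Y]
    exact hw.sub tendsto_const_nhds
  have hA := tendsto_apply_zero_of_equicontinuous hUeq hq0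
  have hsum := (hA.add hUY).add hU
  rw [zero_add, add_comm Y X] at hsum
  refine hsum.congr fun t => ?_
  simp only [map_sub, map_smul, smul_sub]
  abel

/-! ## Composition operators are locally equicontinuous and strongly continuous -/

section Comp

variable (𝕜 : Type*) [RCLike 𝕜] [NormedSpace 𝕜 F] [SMulCommClass ℝ 𝕜 F]

/-- Seminorms of `Φ ∘ L` for `L` near the identity: `p_{k,n}(Φ ∘ L) ≤ 2^{n+k+1} p_{k+1,n+1}(Φ) +
(n 2^n + 1) p_{k,n}(Φ)` whenever `‖L - 1‖ ≤ 1/2`. [folklore] -/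
theorem seminorm_compCLM_le_of_near_one (L : E ≃L[ℝ] E) (hL : ‖(L : E →L[ℝ] E) - 1‖ ≤ 1 / 2)
    (k n : ℕ) (Φ : 𝓢(E, F)) :
    SchwartzMap.seminorm ℝ k n (SchwartzMap.compCLMOfContinuousLinearEquiv 𝕜 L Φ)
      ≤ 2 ^ (n + k + 1) * SchwartzMap.seminorm ℝ (k + 1) (n + 1) Φ
        + (n * 2 ^ n + 1) * SchwartzMap.seminorm ℝ k n Φ := by
  set Ψ := SchwartzMap.compCLMOfContinuousLinearEquiv 𝕜 L Φ
  have h1 : SchwartzMap.seminorm ℝ k n Ψ ≤ SchwartzMap.seminorm ℝ k n (Ψ - Φ)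
      + SchwartzMap.seminorm ℝ k n Φ := by
    calc SchwartzMap.seminorm ℝ k n Ψ = SchwartzMap.seminorm ℝ k n ((Ψ - Φ) + Φ) := by
          rw [sub_add_cancel]
      _ ≤ _ := map_add_le_add _ _ _
  have h2 := seminorm_compCLM_sub_le Φ 𝕜 L hL k n
  have hA : 0 ≤ 2 ^ (n + k + 1) * SchwartzMap.seminorm ℝ (k + 1) (n + 1) Φ
      + n * 2 ^ n * SchwartzMap.seminorm ℝ k n Φ := by
    have := apply_nonneg (SchwartzMap.seminorm ℝ (k + 1) (n + 1)) Φ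
    have := apply_nonneg (SchwartzMap.seminorm ℝ k n) Φ
    positivity
  have h3 : SchwartzMap.seminorm ℝ k n (Ψ - Φ) ≤ 2 ^ (n + k + 1) * SchwartzMap.seminorm ℝ (k + 1) (n + 1) Φ
      + n * 2 ^ n * SchwartzMap.seminorm ℝ k n Φ := by
    refine h2.trans ?_
    calc _ ≤ (2 ^ (n + k + 1) * SchwartzMap.seminorm ℝ (k + 1) (n + 1) Φ
          + n * 2 ^ n * SchwartzMap.seminorm ℝ k n Φ) * 1 := by
          gcongr
          linarith [norm_nonneg ((L : E →L[ℝ] E) - 1)]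
      _ = _ := mul_one _
  linarith

/-- **Local equicontinuity of composition operators**: if `L t → 1` in operator norm along a filter
`l`, then for every `(k, n)` the seminorm `p_{k,n}(Φ ∘ L t)` is eventually bounded by
`C (p_{k,n}(Φ) + p_{k+1,n+1}(Φ))`, uniformly in `Φ`. [folklore] -/
theorem eventually_seminorm_compCLM_le {ι : Type*} {l : Filter ι} {L : ι → (E ≃L[ℝ] E)}
    (hLc : Tendsto (fun t => ((L t : E ≃L[ℝ] E) : E →L[ℝ] E)) l (𝓝 1)) (k n : ℕ) :
    ∃ s : Finset (ℕ × ℕ), ∃ C : ℝ, ∀ᶠ t in l, ∀ Ψ : 𝓢(E, F),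
      SchwartzMap.seminorm ℝ k n (SchwartzMap.compCLMOfContinuousLinearEquiv 𝕜 (L t) Ψ)
        ≤ C * ∑ i ∈ s, SchwartzMap.seminorm ℝ i.1 i.2 Ψ := by
  classical
  refine ⟨{(k, n), (k + 1, n + 1)}, 2 ^ (n + k + 1) + (n * 2 ^ n + 1), ?_⟩
  have hsmall : ∀ᶠ t in l, ‖((L t : E ≃L[ℝ] E) : E →L[ℝ] E) - 1‖ ≤ 1 / 2 := by
    have h := (tendsto_iff_norm_sub_tendsto_zero.mp hLc).eventually_le_const
      (show (0 : ℝ) < 1 / 2 by norm_num)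
    exact h
  filter_upwards [hsmall] with t ht Ψ
  have hne : (k, n) ≠ (k + 1, n + 1) := by simp
  rw [Finset.sum_pair hne]
  have hp0 := apply_nonneg (SchwartzMap.seminorm ℝ k n) Ψ
  have hp1 := apply_nonneg (SchwartzMap.seminorm ℝ (k + 1) (n + 1)) Ψ
  calc _ ≤ 2 ^ (n + k + 1) * SchwartzMap.seminorm ℝ (k + 1) (n + 1) Ψ
        + (n * 2 ^ n + 1) * SchwartzMap.seminorm ℝ k n Ψ :=
        seminorm_compCLM_le_of_near_one 𝕜 (L t) ht k n Ψ
    _ = (2 ^ (n + k + 1) + (n * 2 ^ n + 1))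
        * (SchwartzMap.seminorm ℝ k n Ψ + SchwartzMap.seminorm ℝ (k + 1) (n + 1) Ψ)
        - (2 ^ (n + k + 1) * SchwartzMap.seminorm ℝ k n Ψ
          + (n * 2 ^ n + 1) * SchwartzMap.seminorm ℝ (k + 1) (n + 1) Ψ) := by ring
    _ ≤ (2 ^ (n + k + 1) + (n * 2 ^ n + 1))
        * (SchwartzMap.seminorm ℝ k n Ψ + SchwartzMap.seminorm ℝ (k + 1) (n + 1) Ψ) := by
        have e1 : (0 : ℝ) ≤ 2 ^ (n + k + 1) * SchwartzMap.seminorm ℝ k n Ψ :=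
          mul_nonneg (pow_nonneg (by norm_num) _) hp0
        have e2 : (0 : ℝ) ≤ (n * 2 ^ n + 1) * SchwartzMap.seminorm ℝ (k + 1) (n + 1) Ψ :=
          mul_nonneg (by positivity) hp1
        linarith

/-- **Strong continuity of composition operators on `𝓢`**: `L t → 1` in operator norm implies
`Ψ ∘ L t → Ψ` in the Schwartz topology, for every `Ψ`. [folklore] -/
theorem tendsto_compCLM_of_tendsto_one {ι : Type*} {l : Filter ι} {L : ι → (E ≃L[ℝ] E)}
    (hLc : Tendsto (fun t => ((L t : E ≃L[ℝ] E) : E →L[ℝ] E)) l (𝓝 1)) (Ψ : 𝓢(E, F)) :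
    Tendsto (fun t => SchwartzMap.compCLMOfContinuousLinearEquiv 𝕜 (L t) Ψ) l (𝓝 Ψ) := by
  rw [(schwartz_withSeminorms ℝ E F).tendsto_nhds]
  rintro ⟨k, n⟩ ε hε
  set K : ℝ := 2 ^ (n + k + 1) * SchwartzMap.seminorm ℝ (k + 1) (n + 1) Ψ
    + n * 2 ^ n * SchwartzMap.seminorm ℝ k n Ψ with hK
  have hK0 : 0 ≤ K := by
    have := apply_nonneg (SchwartzMap.seminorm ℝ (k + 1) (n + 1)) Ψ
    have := apply_nonneg (SchwartzMap.seminorm ℝ k n) Ψ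
    positivity
  have h0 := tendsto_iff_norm_sub_tendsto_zero.mp hLc
  have hsmall : ∀ᶠ t in l, ‖((L t : E ≃L[ℝ] E) : E →L[ℝ] E) - 1‖ ≤ 1 / 2 :=
    h0.eventually_le_const (show (0 : ℝ) < 1 / 2 by norm_num)
  have hlt : ∀ᶠ t in l, (K + 1) * ‖((L t : E ≃L[ℝ] E) : E →L[ℝ] E) - 1‖ < ε := by
    have h := h0.const_mul (K + 1)
    rw [mul_zero] at h
    exact h.eventually_lt_const hε
  filter_upwards [hsmall, hlt] with t ht hlt'
  rw [SchwartzMap.schwartzSeminormFamily_apply]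
  calc _ ≤ K * ‖((L t : E ≃L[ℝ] E) : E →L[ℝ] E) - 1‖ := seminorm_compCLM_sub_le Ψ 𝕜 (L t) ht k n
    _ ≤ (K + 1) * ‖((L t : E ≃L[ℝ] E) : E →L[ℝ] E) - 1‖ := by gcongr; linarith
    _ < ε := hlt'

/-- **Linear flow after an arbitrary differentiable trajectory.**  For `L : ℝ → (E ≃L[ℝ] E)` with
`L 0 = 1`, `HasDerivAt L A 0` (operator norm) and any trajectory `w : ℝ → 𝓢(E, F)` with
`t⁻¹ • (w t - Φ) → Y`, the composite satisfies `t⁻¹ • ((w t) ∘ L t - Φ) → flowGen A Φ + Y`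
in `𝓢(E, F)`.  (Typical use: `w t = ` a Heisenberg translation / multiplier family applied to `Φ`,
`L t` a Levi or dilation flow.) [folklore] -/
theorem tendsto_compCLM_apply_sub_div {L : ℝ → (E ≃L[ℝ] E)} {A : E →L[ℝ] E}
    (hL0 : ((L 0 : E ≃L[ℝ] E) : E →L[ℝ] E) = 1)
    (hL : HasDerivAt (fun s => ((L s : E ≃L[ℝ] E) : E →L[ℝ] E)) A 0)
    {w : ℝ → 𝓢(E, F)} {Φ Y : 𝓢(E, F)}
    (hw : Tendsto (fun t : ℝ => t⁻¹ • (w t - Φ)) (𝓝[≠] 0) (𝓝 Y)) :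
    Tendsto (fun t : ℝ => t⁻¹ • (SchwartzMap.compCLMOfContinuousLinearEquiv 𝕜 (L t) (w t) - Φ))
      (𝓝[≠] 0) (𝓝 (flowGen A Φ + Y)) := by
  have hLc : Tendsto (fun t => ((L t : E ≃L[ℝ] E) : E →L[ℝ] E)) (𝓝[≠] 0) (𝓝 1) := by
    have h := hL.continuousAt.tendsto
    rw [hL0] at h
    exact h.mono_left nhdsWithin_le_nhds
  have key := tendsto_comp_sub_div
    (U := fun t => (SchwartzMap.compCLMOfContinuousLinearEquiv 𝕜 (L t)).restrictScalars ℝ)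
    (w := w) (Φ := Φ) (X := flowGen A Φ) (Y := Y)
    (fun k n => by
      simpa only [ContinuousLinearMap.coe_restrictScalars']
        using eventually_seminorm_compCLM_le (F := F) 𝕜 hLc k n)
    (by simpa only [ContinuousLinearMap.coe_restrictScalars']
        using tendsto_compCLM_of_tendsto_one 𝕜 hLc Y)
    (by simpa only [ContinuousLinearMap.coe_restrictScalars']
        using tendsto_compCLM_sub_div 𝕜 hL0 hL Φ)
    hw
  simpa only [ContinuousLinearMap.coe_restrictScalars'] using key

/-- Two linear flows composed: `t⁻¹ • (Φ ∘ L₂ t ∘ L₁ t - Φ) → flowGen A₁ Φ + flowGen A₂ Φ` in `𝓢(E, F)`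
(note `compCLMOfContinuousLinearEquiv 𝕜 (L₁ t) (compCLMOfContinuousLinearEquiv 𝕜 (L₂ t) Φ) = Φ ∘ L₂ t ∘ L₁ t`). [folklore] -/
theorem tendsto_compCLM_compCLM_sub_div {L₁ L₂ : ℝ → (E ≃L[ℝ] E)} {A₁ A₂ : E →L[ℝ] E}
    (h₁0 : ((L₁ 0 : E ≃L[ℝ] E) : E →L[ℝ] E) = 1)
    (h₁ : HasDerivAt (fun s => ((L₁ s : E ≃L[ℝ] E) : E →L[ℝ] E)) A₁ 0)
    (h₂0 : ((L₂ 0 : E ≃L[ℝ] E) : E →L[ℝ] E) = 1)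
    (h₂ : HasDerivAt (fun s => ((L₂ s : E ≃L[ℝ] E) : E →L[ℝ] E)) A₂ 0) (Φ : 𝓢(E, F)) :
    Tendsto (fun t : ℝ => t⁻¹ • (SchwartzMap.compCLMOfContinuousLinearEquiv 𝕜 (L₁ t)
        (SchwartzMap.compCLMOfContinuousLinearEquiv 𝕜 (L₂ t) Φ) - Φ))
      (𝓝[≠] 0) (𝓝 (flowGen A₁ Φ + flowGen A₂ Φ)) :=
  tendsto_compCLM_apply_sub_div 𝕜 h₁0 h₁ (tendsto_compCLM_sub_div 𝕜 h₂0 h₂ Φ)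

end Comp

end Literature.Analysis.Distribution
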